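import Summits.BirchSwinnertonDyer.Rank1Residual.AdditivePotMult.PotMultBudgetRankZeroEnds
import Summits.BirchSwinnertonDyer.Rank1Residual.AdditivePotMult.PotMultWuthrichFirstUnitIndex
import Summits.BirchSwinnertonDyer.Rank1Residual.Additive.X3BranchLowerEndState
import HarnessLib

/-!
# X3♯(M) (REDUCIBLE `E[p]`, potentially multiplicative) ∧ `r_an = 0`, EVERY odd `p` (`p = 3`
# included): the census record at index `b` + n1011-p10's budget `BudgetLeLambdaAt p E b` ⟹ p10's
# INTEGRAL node `QuadraticBranchLowerDivisibilityAt E♭ p` for every twist model ⟹ the branch main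
# conjecture `X3BranchMainConjectureAt E♭ p` ⟹ `BSD(E,p)` — the X3♯(M) twin of n1011-p07's
# `PotMultCongruentPartnerMainConjecture.lean` §2 and `PotMultBudgetRankZeroEnds.lean` §3
# (cell `b2b-bsdres`, team n1011, seat p12 (gen 2), row T-E3dM-X3 sequel)

HONEST FRAMING (cell `b2b-bsdres`, run/shared/lean/b2b/bsd-rank1-residual/, verbatim in every
file): the goal of the cell is to DELETE the COMBINATION-SHAPED residual classes of the
Birch–Swinnerton-Dyer formula for ALL analytic-rank `≤ 1` elliptic curves over `ℚ` — "full BSD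
formula for every rank `≤ 1` curve in class `C`" assembled STRICTLY from published theorems — so
that the rank-`≤ 1` remainder becomes exactly the CONSTRUCTION-SHAPED classes, which are TYPED
(missing-input `Prop`s), NOT attempted. This is not "finishing BSD". Team n1011 (RESIDUAL-MAP §I
N10 LOWER half on the X3♯(M) rows = X3 ∧ pot-mult(p) ∧ `r_an = 0`, every odd `p`): research route
on CONSTRUCTION-SHAPED items; labels and marks UNCHANGED; nothing booked; NO Literature fact minted;
NO definition (currencies of record: census-ctyper1's `CensusQ6.Mult[Odd]FirstUnitIndexAt`, p10's
`BudgetLeLambdaAt` / `QuadraticBranchLowerDivisibilityAt`, p12 gen 1's `X3BranchMainConjectureAt`).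
Named facts enter as HYPOTHESES only: `hW16` = Wuthrich 2014 Thm. 16 (half-eigen divisibility,
REDUCIBLE `E[p]`, `Wuthrich2014.thm16_halfEigenCharIdeal_dvd_cyclotomicPrime`); `hDel` / `hDelX` =
Delbourgo 1998 Prop. 4 ((M) exact form); `hPal` = Pal 2012 Thm. 3.2 (even branch only); GZK `hGZK`;
modularity `hmod`, `hmodD`. A census record is CERTIFICATE-EVIDENCE (two engines), never a fact; the
budget is a typed per-curve input discharged outside the kernel (EPW 2006 §3). Debt 0.

## What and why

p07's FILE 2 §2 / FILE 2b §3 deliver, on X4(M) ∧ surj(p), "BSD_p ⟸ record + budget" through Kato's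
half. On X3♯(M) the image hypothesis is EMPTY (`E[p]`, hence `E♭[p]`, is reducible:
`irr_iff_of_model_twist`) and the divisibility is Wuthrich's Thm. 16; the data-level main conjecture
at the pair is this seat's `charIdeal_eq_span_of_wuthrichHalf_of_norm_coeff_of_budget`
(`PotMultWuthrichFirstUnitIndex.lean`), the ascent of p10's eigen datum is p07 gen 2's
`ChiEigenSelmerInDualData.toSelmerDualData`, the node-to-branch bridge is this seat's
`X3Branch.mainConjectureAt_of_quadraticBranchLower_of_thm16` (`X3BranchLowerDescent.lean`) and the
rank-`0` ends are this seat's `ClassX3M.bsdp_rankZero_of_[forall_]x3BranchMainConjecture[_odd]`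
(`X3BranchLowerEndState.lean`). Everything BY NAME; nothing restated.

* §1 `ClassX3M.forall_quadraticBranchLowerDivisibilityAt_of_wuthrichHalf_of_firstUnitIndex_of_budget[_odd|']`:
  record at index `b` (parity of `(p−1)/2`) + budget ⟹ p10's node for EVERY twist model `E♭`.
* §2 `ClassX3M.forall_x3BranchMainConjectureAt_of_wuthrichHalf_of_firstUnitIndex_of_budget`: hence
  the `ω^{(p−1)/2}`-branch main conjecture of every twist model (row T-c2x3's typed target,
  DISCHARGED per pair modulo record + budget).
* §3 the rank-`0` ENDS: `ClassX3M.bsdp_rankZero_of_wuthrichHalf_of_firstUnitIndex_of_budget` (every odd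
  `p`, `hPal` on the even branch), `…_of_budget_odd` (`p ≡ 3 (mod 4)`, NO `hPal`), `…_three_…`
  (`p = 3`), `…_firstUnitIndex_zero[_odd]` (index `0` = UNIT rows: NO budget, `budgetLeLambdaAt_zero`).

NOT binders: `Surj`, tower, `5 ≤ p`, `¬CM`, `hna`, `hL20`. What is NOT claimed: the budget bound
itself; rows with `b` above the budget; `p = 2`. Labels UNCHANGED; nothing booked; X3 stays
CONSTRUCTION-SHAPED.

BUDGET SOURCE ON X3 ROWS (n1011-r2 GEN 7, ROUTE-2 II.13.2; doc-only scope note): n1011-p10's typed input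
`BudgetLeLambdaAt p W b` is a THEOREM for `b ≤ rank E(ℚ)` (p07's `budgetLeLambdaAt_of_le_mordellWeilRank`);
for `b > rank E(ℚ)` its printed discharge (Emerton–Pollack–Weston 2006 Cor. 3.2.5 + Thm. 3.1.1) assumes
`ρ̄` ABSOLUTELY IRREDUCIBLE, so on X3 (reducible) rows the budget is an UNPRINTED per-pair binder —
candidate discharge Greenberg LNM 1716 Prop. 4.14 (no finite-index Λ-submodule) + Greenberg 2010
(Kyoto J. Math. 50) Prop. 3.2.1 (b) + II.10.9, to be instantiated (sub-target T-E3gX3-bud). Every EPW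
citation below is the source of the typed input on IRREDUCIBLE rows only.

References: C. Wuthrich, Doc. Math. 19 (2014) Thm. 16, §3 [Wuthrich2014]; R. Greenberg, LNM 1716
(1999) §5 [GreenbergLNM1716]; M. Emerton, R. Pollack, T. Weston, Invent. Math. 163 (2006) §3
[EmertonPollackWeston2006]; D. Delbourgo, Compositio Math. 113 (1998) Prop. 4 [Delbourgo1998];
A. Pal, Canad. Math. Bull. 55 (2012) Thm. 3.2 [Pal2012]; C. Skinner, E. Urban, Invent. Math. 195
(2014) Thm. 3.6.4 (shape only) [SkinnerUrban2014]; B. Mazur, J. Tate, J. Teitelbaum, Invent. Math.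
84 (1986) §I.13 [MazurTateTeitelbaum1986Invent]; R. L. Miller, LMS J. Comput. Math. 14 (2011)
Def. 1.1 [Miller2011LMS].
-/

set_option autoImplicit false

noncomputable section

open scoped Classical MatrixGroups ModularForm NumberField

namespace Summit.BirchSwinnertonDyer.Rank1Residual.AdditivePotMult

open CongruenceSubgroup WeierstrassCurve NumberField Literature.NumberTheory.EllipticCurves
  Literature.NumberTheory.EllipticCurves.ModularForms
  Literature.NumberTheory.EllipticCurves.Rank1Residual
  Literature.NumberTheory.EllipticCurves.Rank1Residual.Typed
  Literature.NumberTheory.EllipticCurves.GreenbergVatsal2000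
  Literature.NumberTheory.GaloisRepresentations
  Summit.BirchSwinnertonDyer.Rank1Residual.Additive
  Summit.BirchSwinnertonDyer.Rank1Residual.Additive.CensusQ6
  Summit.BirchSwinnertonDyer.Rank1Residual.Additive.X3Branch
  Summit.BirchSwinnertonDyer.Rank1Residual.X1.MuLambda
  Summit.BirchSwinnertonDyer.Rank1Residual.X11a
  Summit.BirchSwinnertonDyer.Rank1Residual.X11a.LambdaNorm
  Summit.BirchSwinnertonDyer.Rank1Residual.Iwasawa
  IsDedekindDomain

variable {W : WeierstrassCurve ℚ} [W.IsElliptic] [W.IsGloballyMinimal] {p : ℕ} [hp : Fact p.Prime]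

/-! ### §1 K-OUT on X3♯(M), integral node: p10's `QuadraticBranchLowerDivisibilityAt E♭ p` at every twist model -/

/-- **X3♯(M), `p ≡ 1 (mod 4)`: record at index `b` + budget ⟹ n1011-p10's INTEGRAL node
`QuadraticBranchLowerDivisibilityAt V p` for EVERY globally minimal twist model `V` (`C • V^{(p*)} = W`).**
p07's X4(M) proof with the tower line replaced by reducibility of `V[p]` (`irr_iff_of_model_twist`):
`V` is multiplicative (`ClassX3M.mult_of_twist_model_pStar`), `a_p = ±1`, the record supplies
`‖[T^b](ϖ·B)‖ = 1`, the eigen datum ascends (`ChiEigenSelmerInDualData.toSelmerDualData`) and the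
main conjecture there (`charIdeal_eq_span_of_wuthrichHalf_of_norm_coeff_of_budget`) makes every
`g ∈ char` a `Λ`-multiple of `ϖ·B`. [cite: Wuthrich2014, Thm. 16 (p. 397)]
[cite: GreenbergLNM1716, §5 (PDF p. 143)] [cite: SkinnerUrban2014, Thm. 3.6.4 (p. 43) (shape only; nothing asserted)]
[cite: EmertonPollackWeston2006, Cor. 3.2.5 and Thm. 3.1.1 (typed input's source on IRREDUCIBLE rows only; X3: see header)] -/
theorem ClassX3M.forall_quadraticBranchLowerDivisibilityAt_of_wuthrichHalf_of_firstUnitIndex_of_budget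
    (hW16 : Wuthrich2014.thm16_halfEigenCharIdeal_dvd_cyclotomicPrime)
    (hX : ClassX3M W p) (hp4 : p % 4 = 1) {b : ℕ}
    (hrec : MultFirstUnitIndexAt W p b) (hbud : BudgetLeLambdaAt p W b)
    (V : WeierstrassCurve ℚ) [V.IsElliptic] [V.IsGloballyMinimal]
    (hVW : ∃ C : VariableChange ℚ, C • V.quadraticTwist ((-1) ^ (p / 2) * p : ℚ) = W) :
    QuadraticBranchLowerDivisibilityAt V p := by
  intro K _ _ _ F _ _ _ _ κ γ N _ f B hp2 hK2 hθ hB hκ hγ hcv hγK hγF hf D ϖ hϖ g hg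
  have heven : Even (p / 2) := ⟨p / 4, by omega⟩
  have hpS : ((-1 : ℚ) ^ (p / 2) * p) ≠ 0 :=
    mul_ne_zero (pow_ne_zero _ (by norm_num)) (Nat.cast_ne_zero.mpr hp.out.ne_zero)
  obtain ⟨C, hC⟩ := hVW
  have hV : Mult V p := hX.mult_of_twist_model_pStar V C hC
  have hirrV : ¬ V.HasIrreducibleModPGaloisRep p := fun hVirr ↦
    hX.classX3.1 ((irr_iff_of_model_twist (W := V) (p := p) (pStar_ne_zero p) ⟨C, hC⟩).mpr hVirr)
  -- the record's unit coefficient for THIS branch series (`V` multiplicative: `a_p = ±1`)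
  have hn : ‖PowerSeries.coeff b (PowerSeries.C (ϖ : ℚ_[p]) * B)‖ = 1 := by
    have hC' : C • V.quadraticTwist (p : ℚ) = W := by
      rw [← pStar_eq_self_of_mod_four_eq_one hp4]; exact hC
    have hϖ' : (ϖ : ℝ) * V.realPeriodRat = plusPeriod f := by rw [if_pos heven] at hϖ; exact hϖ
    rcases hB with ⟨hord, -⟩ | ⟨hs, hBeq⟩ | ⟨hm, hns, hBeq⟩
    · exact absurd ((isOrdinaryAt_iff V p).mp hord).1
        (fun hgood => WeierstrassCurve.HasMultiplicativeReduction.not_hasGoodReduction (R := ℤ_[p]) hV hgood)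
    · obtain ⟨h1, -⟩ := hf.cuspCoeff_eq_one_and_sq_of_split hs
      have h := (hrec V C hV hC' f hf 1 (by exact_mod_cast h1) ϖ hϖ').2
      rw [Int.cast_one] at h
      rw [hBeq, if_pos heven]; exact h
    · obtain ⟨h1, -⟩ := hf.cuspCoeff_eq_neg_one_and_dvd_of_nonsplit hm hns
      have h := (hrec V C hV hC' f hf (-1) (by exact_mod_cast h1) ϖ hϖ').2
      rw [Int.cast_neg, Int.cast_one] at h
      rw [hBeq, if_pos heven]; exact h
  -- ascend the eigen datum to a cyclotomic dual datum of `Sel_{p^∞}(W/ℚ_∞)` at `γ`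
  obtain ⟨θ, hθ2⟩ := hθ
  have hθnr : θ ∉ Set.range (algebraMap ℚ K) := not_mem_range_algebraMap_of_sq_eq_pStar hθ2
  haveI : (V.quadraticTwist ((-1 : ℚ) ^ (p / 2) * p)).IsElliptic := V.isElliptic_quadraticTwist hpS
  let D' : W.SelmerDualData κ γ :=
    ChiEigenSelmerInDualData.toSelmerDualData V K hK2 hθnr hθ2 p κ hC (galRange (K := ℚ) F)
      (isOpen_galRange F) (coprime_index_galRange_cyclotomic p F) hp2 hγK D
  obtain ⟨-, g₀, hchar, ⟨u, hι⟩, -, -, -⟩ := charIdeal_eq_span_of_wuthrichHalf_of_norm_coeff_of_budget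
    hW16 hp2 hbud V C hC hirrV hκ hγ hcv hf D' B hB ϖ hϖ hn
  -- `g ∈ char D.X = char D' = (g₀)`, `ι g₀ = C(u·ϖ)·B`
  have hg' : g ∈ D'.charIdeal := hg
  rw [hchar] at hg'
  obtain ⟨h, rfl⟩ := Ideal.mem_span_singleton'.mp hg'
  have hCu : iwasawaToPowerSeries p (PowerSeries.C (u : ℤ_[p])) =
      PowerSeries.C (((u : ℤ_[p]) : ℚ_[p])) := by
    rw [← mul_one (PowerSeries.C (u : ℤ_[p])), iwasawaToPowerSeries_C_mul', map_one, mul_one]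
  refine ⟨PowerSeries.C (u : ℤ_[p]) * h, ?_⟩
  simp only [map_mul, hι, hCu]
  ring

/-- **X3♯(M), `p ≡ 3 (mod 4)` (`p = 3` included): record at index `b` + budget ⟹
`QuadraticBranchLowerDivisibilityAt V p` for EVERY globally minimal twist model `V` (`C • V^{(−p)} = W`;
minus branch, minus period).** [cite: Wuthrich2014, Thm. 16 (p. 397)]
[cite: GreenbergLNM1716, §5 (PDF p. 143)] [cite: SkinnerUrban2014, Thm. 3.6.4 (p. 43) (shape only; nothing asserted)]
[cite: EmertonPollackWeston2006, Cor. 3.2.5 and Thm. 3.1.1 (typed input's source on IRREDUCIBLE rows only; X3: see header)] -/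
theorem ClassX3M.forall_quadraticBranchLowerDivisibilityAt_of_wuthrichHalf_of_firstUnitIndex_of_budget_odd
    (hW16 : Wuthrich2014.thm16_halfEigenCharIdeal_dvd_cyclotomicPrime)
    (hX : ClassX3M W p) (hp4 : p % 4 = 3) {b : ℕ}
    (hrec : MultOddFirstUnitIndexAt W p b) (hbud : BudgetLeLambdaAt p W b)
    (V : WeierstrassCurve ℚ) [V.IsElliptic] [V.IsGloballyMinimal]
    (hVW : ∃ C : VariableChange ℚ, C • V.quadraticTwist ((-1) ^ (p / 2) * p : ℚ) = W) :
    QuadraticBranchLowerDivisibilityAt V p := by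
  intro K _ _ _ F _ _ _ _ κ γ N _ f B hp2 hK2 hθ hB hκ hγ hcv hγK hγF hf D ϖ hϖ g hg
  have hodd : ¬ Even (p / 2) := by rw [Nat.not_even_iff_odd]; exact ⟨p / 4, by omega⟩
  have hpS : ((-1 : ℚ) ^ (p / 2) * p) ≠ 0 :=
    mul_ne_zero (pow_ne_zero _ (by norm_num)) (Nat.cast_ne_zero.mpr hp.out.ne_zero)
  obtain ⟨C, hC⟩ := hVW
  have hV : Mult V p := hX.mult_of_twist_model_pStar V C hC
  have hirrV : ¬ V.HasIrreducibleModPGaloisRep p := fun hVirr ↦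
    hX.classX3.1 ((irr_iff_of_model_twist (W := V) (p := p) (pStar_ne_zero p) ⟨C, hC⟩).mpr hVirr)
  have hn : ‖PowerSeries.coeff b (PowerSeries.C (ϖ : ℚ_[p]) * B)‖ = 1 := by
    have hC' : C • V.quadraticTwist (-(p : ℚ)) = W := by
      rw [← pStar_eq_neg_of_mod_four_eq_three hp4]; exact hC
    have hϖ' : (ϖ : ℝ) * V.imaginaryPeriodRat = minusPeriod f := by
      rw [if_neg hodd] at hϖ; exact hϖ
    rcases hB with ⟨hord, -⟩ | ⟨hs, hBeq⟩ | ⟨hm, hns, hBeq⟩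
    · exact absurd ((isOrdinaryAt_iff V p).mp hord).1
        (fun hgood => WeierstrassCurve.HasMultiplicativeReduction.not_hasGoodReduction (R := ℤ_[p]) hV hgood)
    · obtain ⟨h1, -⟩ := hf.cuspCoeff_eq_one_and_sq_of_split hs
      have h := (hrec V C hV hC' f hf 1 (by exact_mod_cast h1) ϖ hϖ').2
      rw [Int.cast_one] at h
      rw [hBeq, if_neg hodd]; exact h
    · obtain ⟨h1, -⟩ := hf.cuspCoeff_eq_neg_one_and_dvd_of_nonsplit hm hns
      have h := (hrec V C hV hC' f hf (-1) (by exact_mod_cast h1) ϖ hϖ').2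
      rw [Int.cast_neg, Int.cast_one] at h
      rw [hBeq, if_neg hodd]; exact h
  obtain ⟨θ, hθ2⟩ := hθ
  have hθnr : θ ∉ Set.range (algebraMap ℚ K) := not_mem_range_algebraMap_of_sq_eq_pStar hθ2
  haveI : (V.quadraticTwist ((-1 : ℚ) ^ (p / 2) * p)).IsElliptic := V.isElliptic_quadraticTwist hpS
  let D' : W.SelmerDualData κ γ :=
    ChiEigenSelmerInDualData.toSelmerDualData V K hK2 hθnr hθ2 p κ hC (galRange (K := ℚ) F)
      (isOpen_galRange F) (coprime_index_galRange_cyclotomic p F) hp2 hγK D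
  obtain ⟨-, g₀, hchar, ⟨u, hι⟩, -, -, -⟩ := charIdeal_eq_span_of_wuthrichHalf_of_norm_coeff_of_budget
    hW16 hp2 hbud V C hC hirrV hκ hγ hcv hf D' B hB ϖ hϖ hn
  have hg' : g ∈ D'.charIdeal := hg
  rw [hchar] at hg'
  obtain ⟨h, rfl⟩ := Ideal.mem_span_singleton'.mp hg'
  have hCu : iwasawaToPowerSeries p (PowerSeries.C (u : ℤ_[p])) =
      PowerSeries.C (((u : ℤ_[p]) : ℚ_[p])) := by
    rw [← mul_one (PowerSeries.C (u : ℤ_[p])), iwasawaToPowerSeries_C_mul', map_one, mul_one]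
  refine ⟨PowerSeries.C (u : ℤ_[p]) * h, ?_⟩
  simp only [map_mul, hι, hCu]
  ring

/-- **Parity-free form, EVERY odd `p`**: on X3♯(M), the record of the parity of `(p−1)/2` at index
`b` + the budget ⟹ p10's node for every twist model. [cite: Wuthrich2014, Thm. 16 (p. 397)] -/
theorem ClassX3M.forall_quadraticBranchLowerDivisibilityAt_of_wuthrichHalf_of_firstUnitIndex_of_budget'
    (hW16 : Wuthrich2014.thm16_halfEigenCharIdeal_dvd_cyclotomicPrime)
    (hX : ClassX3M W p) {b : ℕ}
    (hrec : (p % 4 = 1 → MultFirstUnitIndexAt W p b) ∧ (p % 4 = 3 → MultOddFirstUnitIndexAt W p b))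
    (hbud : BudgetLeLambdaAt p W b)
    (V : WeierstrassCurve ℚ) [V.IsElliptic] [V.IsGloballyMinimal]
    (hVW : ∃ C : VariableChange ℚ, C • V.quadraticTwist ((-1) ^ (p / 2) * p : ℚ) = W) :
    QuadraticBranchLowerDivisibilityAt V p := by
  obtain ⟨k, hk⟩ : Odd p := hp.out.odd_of_ne_two hX.p_ne_two
  rcases (show p % 4 = 1 ∨ p % 4 = 3 by omega) with hp4 | hp4
  · exact hX.forall_quadraticBranchLowerDivisibilityAt_of_wuthrichHalf_of_firstUnitIndex_of_budget hW16
      hp4 (hrec.1 hp4) hbud V hVW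
  · exact hX.forall_quadraticBranchLowerDivisibilityAt_of_wuthrichHalf_of_firstUnitIndex_of_budget_odd
      hW16 hp4 (hrec.2 hp4) hbud V hVW

/-! ### §2 Hence the `ω^{(p−1)/2}`-branch MAIN CONJECTURE of every twist model (row T-c2x3's target) -/

/-- **X3♯(M), EVERY odd `p`: record at index `b` + budget ⟹ `X3BranchMainConjectureAt V p` for EVERY
twist model `V`** — §1 through this seat's Λ-level bridge
`X3Branch.mainConjectureAt_of_quadraticBranchLower_of_thm16` (`hW16` again). Row T-c2x3's typed
target DISCHARGED per pair modulo the record and the budget; nothing booked.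
[cite: Wuthrich2014, Thm. 16 (p. 397)] [cite: GreenbergVatsal2000, (1.1) and p. 4] -/
theorem ClassX3M.forall_x3BranchMainConjectureAt_of_wuthrichHalf_of_firstUnitIndex_of_budget
    (hW16 : Wuthrich2014.thm16_halfEigenCharIdeal_dvd_cyclotomicPrime)
    (hX : ClassX3M W p) {b : ℕ}
    (hrec : (p % 4 = 1 → MultFirstUnitIndexAt W p b) ∧ (p % 4 = 3 → MultOddFirstUnitIndexAt W p b))
    (hbud : BudgetLeLambdaAt p W b)
    (V : WeierstrassCurve ℚ) [V.IsElliptic] [V.IsGloballyMinimal]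
    (hVW : ∃ C : VariableChange ℚ, C • V.quadraticTwist ((-1) ^ (p / 2) * p : ℚ) = W) :
    X3BranchMainConjectureAt V p :=
  X3Branch.mainConjectureAt_of_quadraticBranchLower_of_thm16 hW16
    (hX.forall_quadraticBranchLowerDivisibilityAt_of_wuthrichHalf_of_firstUnitIndex_of_budget' hW16 hrec
      hbud V hVW)

/-! ### §3 The rank-`0` ENDS on X3♯(M), EVERY odd `p`, by this seat's T-c2x3 (v) consumers -/

/-- **X3♯(M) ∧ `r_an = 0`, EVERY odd `p` (`p = 3` included): `BSD(E,p)` ⟸ the census record at index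
`b` (parity of `(p−1)/2`) + the budget `BudgetLeLambdaAt p E b`** (modulo {hW16, hDel, hDelX, hPal,
hGZK, hmod, hmodD}) — §2 into `ClassX3M.bsdp_rankZero_of_forall_x3BranchMainConjecture`. PER PAIR;
EVIDENCE-tier inputs; X3 stays CONSTRUCTION-SHAPED; nothing booked. NO image / tower / `5 ≤ p` / CM /
anomalous binder. [cite: Wuthrich2014, Thm. 16 (p. 397)] [cite: Delbourgo1998, Prop. 4 (p. 144)]
[cite: Pal2012, Thm. 3.2] [cite: Miller2011LMS, §1 and Def. 1.1]
[cite: EmertonPollackWeston2006, Cor. 3.2.5 and Thm. 3.1.1 (typed input's source on IRREDUCIBLE rows only; X3: see header)] -/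
theorem ClassX3M.bsdp_rankZero_of_wuthrichHalf_of_firstUnitIndex_of_budget
    (hW16 : Wuthrich2014.thm16_halfEigenCharIdeal_dvd_cyclotomicPrime)
    (hDel : Delbourgo1998.prop4_rankZero_pow_dvd_constantCoeff)
    (hDelX : Delbourgo1998.prop4_rankZero_constantCoeff_eq_unit_mul_of_potMult)
    (hPal : Pal2012.thm32_sqrt_mul_realPeriodRat_twist_eq_of_prime_one_mod_four)
    (hGZK : rank_eq_analyticRank_of_analyticRank_le_one) (hmod : hasEntireLFunction_rat)
    (hmodD : nonempty_modularParametrizationData)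
    (hX : ClassX3M W p) (hr : W.analyticRank = 0) {b : ℕ}
    (hrec : (p % 4 = 1 → MultFirstUnitIndexAt W p b) ∧ (p % 4 = 3 → MultOddFirstUnitIndexAt W p b))
    (hbud : BudgetLeLambdaAt p W b) : BSDp W p :=
  ClassX3M.bsdp_rankZero_of_forall_x3BranchMainConjecture hDel hDelX hPal hGZK hmod hmodD hW16 hX hr
    (fun V _ _ hVW ↦
      hX.forall_x3BranchMainConjectureAt_of_wuthrichHalf_of_firstUnitIndex_of_budget hW16 hrec hbud V hVW)

/-- **Pal-free odd form: X3♯(M) ∧ `r_an = 0`, `p ≡ 3 (mod 4)` (`p = 3` included): `BSD(E,p)` ⟸ the odd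
record `MultOddFirstUnitIndexAt W p b` + the budget** (NO `hPal`: Pal for `d < 0` is a tree theorem;
`ClassX3M.bsdp_rankZero_of_x3BranchMainConjecture_odd`). [cite: Wuthrich2014, Thm. 16 (p. 397)]
[cite: Delbourgo1998, Prop. 4 (p. 144) and §2.2 Lemma (ii) (p. 139)] [cite: Miller2011LMS, Def. 1.1] -/
theorem ClassX3M.bsdp_rankZero_of_wuthrichHalf_of_firstUnitIndex_of_budget_odd
    (hW16 : Wuthrich2014.thm16_halfEigenCharIdeal_dvd_cyclotomicPrime)
    (hDel : Delbourgo1998.prop4_rankZero_pow_dvd_constantCoeff)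
    (hDelX : Delbourgo1998.prop4_rankZero_constantCoeff_eq_unit_mul_of_potMult)
    (hGZK : rank_eq_analyticRank_of_analyticRank_le_one) (hmod : hasEntireLFunction_rat)
    (hmodD : nonempty_modularParametrizationData)
    (hX : ClassX3M W p) (hp4 : p % 4 = 3) (hr : W.analyticRank = 0) {b : ℕ}
    (hrec : MultOddFirstUnitIndexAt W p b) (hbud : BudgetLeLambdaAt p W b) : BSDp W p :=
  ClassX3M.bsdp_rankZero_of_x3BranchMainConjecture_odd hDel hDelX hGZK hmod hmodD hW16 hX hp4 hr
    (fun V _ _ hVW ↦ X3Branch.mainConjectureAt_of_quadraticBranchLower_of_thm16 hW16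
      (hX.forall_quadraticBranchLowerDivisibilityAt_of_wuthrichHalf_of_firstUnitIndex_of_budget_odd hW16
        hp4 hrec hbud V hVW))

/-- **`p = 3` specialisation (the N10 X3♯(M) rows at `3`):** X3♯(M)@3 ∧ `r_an = 0`, record
`MultOddFirstUnitIndexAt W 3 b` (odd branch: twist by `−3`, `Ω⁻`) + budget ⟹ `BSD(E,3)`; NO `hPal`,
NO image hypothesis. [cite: Wuthrich2014, Thm. 16 (p. 397)] [cite: Delbourgo1998, Prop. 4 (p. 144)]
[cite: Miller2011LMS, Def. 1.1] -/
theorem ClassX3M.bsdp_three_rankZero_of_wuthrichHalf_of_firstUnitIndex_of_budget [Fact (Nat.Prime 3)]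
    {W : WeierstrassCurve ℚ} [W.IsElliptic] [W.IsGloballyMinimal]
    (hW16 : Wuthrich2014.thm16_halfEigenCharIdeal_dvd_cyclotomicPrime)
    (hDel : Delbourgo1998.prop4_rankZero_pow_dvd_constantCoeff)
    (hDelX : Delbourgo1998.prop4_rankZero_constantCoeff_eq_unit_mul_of_potMult)
    (hGZK : rank_eq_analyticRank_of_analyticRank_le_one) (hmod : hasEntireLFunction_rat)
    (hmodD : nonempty_modularParametrizationData)
    (hX : ClassX3M W 3) (hr : W.analyticRank = 0) {b : ℕ}
    (hrec : MultOddFirstUnitIndexAt W 3 b) (hbud : BudgetLeLambdaAt 3 W b) : BSDp W 3 :=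
  hX.bsdp_rankZero_of_wuthrichHalf_of_firstUnitIndex_of_budget_odd hW16 hDel hDelX hGZK hmod hmodD
    (by decide) hr hrec hbud

/-- **Index `0` (UNIT constant term) needs NO budget: X3♯(M) ∧ `r_an = 0`, EVERY odd `p`, record at
index `0` ⟹ `BSD(E,p)`** (`budgetLeLambdaAt_zero`, p07). A CONSISTENCY with the unit-row chains;
nothing new is covered and nothing is booked. [cite: Wuthrich2014, Thm. 16 (p. 397)]
[cite: Delbourgo1998, Prop. 4 (p. 144)] [cite: Miller2011LMS, Def. 1.1] -/
theorem ClassX3M.bsdp_rankZero_of_wuthrichHalf_of_firstUnitIndex_zero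
    (hW16 : Wuthrich2014.thm16_halfEigenCharIdeal_dvd_cyclotomicPrime)
    (hDel : Delbourgo1998.prop4_rankZero_pow_dvd_constantCoeff)
    (hDelX : Delbourgo1998.prop4_rankZero_constantCoeff_eq_unit_mul_of_potMult)
    (hPal : Pal2012.thm32_sqrt_mul_realPeriodRat_twist_eq_of_prime_one_mod_four)
    (hGZK : rank_eq_analyticRank_of_analyticRank_le_one) (hmod : hasEntireLFunction_rat)
    (hmodD : nonempty_modularParametrizationData)
    (hX : ClassX3M W p) (hr : W.analyticRank = 0)
    (hrec : (p % 4 = 1 → MultFirstUnitIndexAt W p 0) ∧ (p % 4 = 3 → MultOddFirstUnitIndexAt W p 0)) :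
    BSDp W p :=
  hX.bsdp_rankZero_of_wuthrichHalf_of_firstUnitIndex_of_budget hW16 hDel hDelX hPal hGZK hmod hmodD hr
    hrec budgetLeLambdaAt_zero

/-- **Index `0`, Pal-free odd form** (`p ≡ 3 (mod 4)` incl. `p = 3`): X3♯(M) ∧ `r_an = 0`, odd record at
index `0` ⟹ `BSD(E,p)`, NO budget, NO `hPal`. [cite: Wuthrich2014, Thm. 16 (p. 397)]
[cite: Delbourgo1998, Prop. 4 (p. 144)] [cite: Miller2011LMS, Def. 1.1] -/
theorem ClassX3M.bsdp_rankZero_of_wuthrichHalf_of_firstUnitIndex_zero_odd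
    (hW16 : Wuthrich2014.thm16_halfEigenCharIdeal_dvd_cyclotomicPrime)
    (hDel : Delbourgo1998.prop4_rankZero_pow_dvd_constantCoeff)
    (hDelX : Delbourgo1998.prop4_rankZero_constantCoeff_eq_unit_mul_of_potMult)
    (hGZK : rank_eq_analyticRank_of_analyticRank_le_one) (hmod : hasEntireLFunction_rat)
    (hmodD : nonempty_modularParametrizationData)
    (hX : ClassX3M W p) (hp4 : p % 4 = 3) (hr : W.analyticRank = 0)
    (hrec : MultOddFirstUnitIndexAt W p 0) : BSDp W p :=
  hX.bsdp_rankZero_of_wuthrichHalf_of_firstUnitIndex_of_budget_odd hW16 hDel hDelX hGZK hmod hmodD hp4 hr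
    hrec budgetLeLambdaAt_zero

end Summit.BirchSwinnertonDyer.Rank1Residual.AdditivePotMult

end
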